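import Literature.NumberTheory.EllipticCurves.LambdaAdicSelmerDataTorsionPowReduce
import Literature.NumberTheory.EllipticCurves.ZpExtensionCoeffTwistReduceCompProofs
import Literature.NumberTheory.EllipticCurves.ZpExtensionEisensteinAdicTower
import Literature.NumberTheory.GaloisCohomology.Howard2004.TowerReindex
import HarnessLib

/-!
# The `f_red` compatibility of the pushforward's level maps: iterated reductions of the `Λ`-adic tower as ONE
# coefficient/module change, D1's Eisenstein reductions as coefficient/module changes, and the commuting square
# `f_k ∘ redIter_σ = red′_k ∘ f_{k+1}` from the Shapiro-diagonal source to the Eisenstein target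
# (definitions with bodies + theorems)

Topic `NumberTheory/EllipticCurves` (sequel of `LambdaAdicSelmerDataTorsionPowReduce`, `ZpExtensionCoeffTwistReduceCompProofs`,
`ZpExtensionCoeffAdicTower`, `ZpExtensionEisensteinAdicTower`). Cell `pub/bsd-print-x9`, seat `bsd-line-x9-p2` (g3): STUB A
(`stub_howardInputs`) of the shared μ-skeleton v3 (x9-p1 LEAD g3 17:24:48Z) needs ONE `CoeffTowerSetting.Hom` from the
(reindexed) Shapiro-diagonal source `S_Λ` (lit tranche 5 on `coeffAdicTower`) into D1's `eisensteinDVRSetting`; its field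
`f_red : f k (S.T.red k x) = S′.T.red k (f (k+1) x)` — with `S.T = T_Λ.reindex s₀ d` (lit `AdicTower.reindex`, `red = redIter`)
and `S′.T = eisensteinAdicTowerSucc` — is the content of this file, for the level maps `f k := shapiroToEisensteinTwistLe`.

* `ZpExtension.redModIter t k d : M_{k+d} →ⁱL M_k` (iterate of the one-step maps of an inverse system) and, for `M_k = E[p^k]`,
  `coe_redModIter` (`= p^d • P` on points, given the lifts are `p ·`);
* `ZpExtension.le_of_succ_le` (`I (k+d) ≤ I k`), **`redIter_coeffAdicTower_apply`**: `T.redIter k d` IS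
  `coeffTwistReduce (Λ/I(k+d) ↠ Λ/I k) (redModIter t k d)`;
* **`eisensteinTwistReduce_eq_coeffTwistReduce`**: D1's `eisensteinTwistReduce hm hkk′ f` IS `coeffTwistReduce (reduce p m hkk′) f`;
* **`shapiroToEisensteinTwistLe_redIter`**: for `σ′ = σ + d`, `k + 1 ≤ σ`, `k + 2 ≤ σ′` and the two ideal inclusions,
  `f_{σ,k+1} (T_Λ.redIter σ d x) = eisensteinTwistReduce hm (k+1 ≤ k+2) (t (k+1)) (f_{σ′,k+2} x)` — the `f_red` square of the
  `Hom` at consecutive target levels (source `red` = `redIter`, any reindexing `σ = idxSeq s₀ d k`).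
DEFINITIONS WITH BODIES + theorems; no named fact, no instance, no notation, no `sorry`. BSD is not proved by any of this.

References: [Howard2004HeegnerKolyvagin] B. Howard, Compositio Math. 140 (2004), Rem. 1.2.4 (arXiv Rem. 2.2.4, p. 7, L13–27),
§1.6 (arXiv p. 12, L29–33), §2.2 Def. 2.2.3; [Washington1997] §13.1–§13.2; [SilvermanAEC2009] III.§7.
-/

noncomputable section

open scoped Topology Classical ContRepresentation
open Field CategoryTheory IsLocalRing

namespace Literature.NumberTheory.EllipticCurves.ZpExtension

open Literature.NumberTheory.GaloisRepresentations
open Literature.NumberTheory.GaloisCohomology.Howard2004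

/-! ## §1 Iterates of an inverse system of discrete Galois modules -/

section Iter

variable {K : Type} [Field K] {M : ℕ → Type} [∀ k, AddCommGroup (M k)] [∀ k, TopologicalSpace (M k)]
  [∀ k, DiscreteTopology (M k)] {ρ : ∀ k, DiscreteGaloisModule K (M k)}
  (t : ∀ k, (ρ (k + 1)).toContRepresentation →ⁱL (ρ k).toContRepresentation)

/-- **The iterate `M_{k+d} → M_k`** of the one-step maps `t` of an inverse system of discrete Galois modules
(`t_k ∘ ⋯ ∘ t_{k+d-1}`), as a continuous intertwining map. [cite: Howard2004HeegnerKolyvagin, §1.6 (arXiv p. 12, L29–33)] -/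
def redModIter (k : ℕ) : ∀ d : ℕ, (ρ (k + d)).toContRepresentation →ⁱL (ρ k).toContRepresentation
  | 0 => ContIntertwiningMap.id
  | d + 1 => (redModIter k d).comp (t (k + d))

/-- `redModIter t k 0 = id`. [cite: Howard2004HeegnerKolyvagin, §1.6] -/
theorem redModIter_zero_apply (k : ℕ) (x : M (k + 0)) : redModIter t k 0 x = x := rfl

/-- `redModIter t k (d+1) = redModIter t k d ∘ t (k+d)`. [cite: Howard2004HeegnerKolyvagin, §1.6] -/
theorem redModIter_succ_apply (k d : ℕ) (x : M (k + d + 1)) :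
    redModIter t k (d + 1) x = redModIter t k d (t (k + d) x) := rfl

end Iter

section IterE

variable {K : Type} [Field K] (V : WeierstrassCurve K) (p : ℕ)
  (t : ∀ k, (V.torsionGaloisModule ((p : ℤ) ^ (k + 1))).toContRepresentation →ⁱL
    (V.torsionGaloisModule ((p : ℤ) ^ k)).toContRepresentation)
  (ht : ∀ k (P : WeierstrassCurve.geomTorsion V ((p : ℤ) ^ (k + 1))), t k P = V.geomTorsionReduce p k P)

include ht in
/-- For `M_k = E[p^k]` and lifts `t` of `p ·`: `redModIter t k d P = p^d • P` on points. [cite: SilvermanAEC2009, III.§7] -/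
theorem coe_redModIter (k : ℕ) : ∀ (d : ℕ) (P : WeierstrassCurve.geomTorsion V ((p : ℤ) ^ (k + d))),
    ((redModIter (ρ := fun j ↦ V.torsionGaloisModule ((p : ℤ) ^ j)) t k d P :
      WeierstrassCurve.geomTorsion V ((p : ℤ) ^ k)) : WeierstrassCurve.geomPoints V) =
      (p : ℤ) ^ d • (P : WeierstrassCurve.geomPoints V)
  | 0, P => by rw [pow_zero, one_smul]; rfl
  | d + 1, P => by
    rw [show redModIter (ρ := fun j ↦ V.torsionGaloisModule ((p : ℤ) ^ j)) t k (d + 1) P =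
        redModIter (ρ := fun j ↦ V.torsionGaloisModule ((p : ℤ) ^ j)) t k d (t (k + d) P) from rfl,
      coe_redModIter k d, ht, WeierstrassCurve.coe_geomTorsionReduce, smul_smul, ← pow_succ]

include ht in
/-- `redModIter t k d` agrees with `torsionGaloisModulePowReduce (k+d) k` pointwise. [cite: SilvermanAEC2009, III.§7] -/
theorem redModIter_eq_torsionGaloisModulePowReduce (k d : ℕ) (P : WeierstrassCurve.geomTorsion V ((p : ℤ) ^ (k + d))) :
    redModIter (ρ := fun j ↦ V.torsionGaloisModule ((p : ℤ) ^ j)) t k d P =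
      V.torsionGaloisModulePowReduce p (k + d) k (Nat.le_add_right k d) P :=
  Subtype.ext (by rw [coe_redModIter V p t ht k d P, WeierstrassCurve.coe_torsionGaloisModulePowReduce, Nat.add_sub_cancel_left])

end IterE

/-! ## §2 Iterated reductions of the `Λ`-adic tower as one coefficient/module change -/

section Tower

variable {K : Type} [Field K] {p : ℕ} [hp : Fact p.Prime] (κ : ZpExtension K p)
  {M : ℕ → Type} [∀ k, AddCommGroup (M k)] [∀ k, TopologicalSpace (M k)] [∀ k, DiscreteTopology (M k)]
  (ρ : ∀ k, DiscreteGaloisModule K (M k))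
  (t : ∀ k, (ρ (k + 1)).toContRepresentation →ⁱL (ρ k).toContRepresentation)
  (I : ℕ → Ideal (IwasawaAlgebra p)) (hI : ∀ k, I (k + 1) ≤ I k)
  (J : ℕ → ℕ) (hJ : ∀ k, ((1 + PowerSeries.X : IwasawaAlgebra p) ^ (p ^ J k) - 1) ∈ I k)
  (e : ℕ → ℕ) (he : ∀ k, maximalIdeal (IwasawaAlgebra p) ^ e k ≤ I k) (ht : ∀ k, Function.Surjective (t k))

include hI in
/-- `I (k + d) ≤ I k` for an antitone family. [cite: Howard2004HeegnerKolyvagin, §2.2 Def. 2.2.3] -/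
theorem le_of_succ_le (k d : ℕ) : I (k + d) ≤ I k :=
  antitone_nat_of_succ_le hI (Nat.le_add_right k d)

/-- `Ideal.Quotient.factor` carries `[1+T]` to `[1+T]` (iterated levels). [cite: Washington1997, §13.1] -/
theorem factor_coeffLevelUnit_of_le {k k' : ℕ} (h : I k' ≤ I k) :
    Ideal.Quotient.factor h (coeffLevelUnit I k') = coeffLevelUnit I k :=
  Ideal.Quotient.factor_mk _ _

/-- **`T.redIter k d` IS the coefficient/module change along `Λ/I(k+d) ↠ Λ/I k` and `redModIter t k d`.**
[cite: Howard2004HeegnerKolyvagin, §1.6 (arXiv p. 12, L29–33) and §2.2 Def. 2.2.3] -/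
theorem redIter_coeffAdicTower_apply (k : ℕ) : ∀ (d : ℕ) (x : CoeffLevel p I M (k + d)),
    (κ.coeffAdicTower ρ t I hI J hJ e he ht).redIter k d x =
      κ.coeffTwistReduce (mk_one_add_X_pow_prime_pow_eq_one (I (k + d)) (hJ (k + d)))
        (mk_one_add_X_pow_prime_pow_eq_one (I k) (hJ k)) (Ideal.Quotient.factor (le_of_succ_le I hI k d))
        (factor_coeffLevelUnit_of_le I (le_of_succ_le I hI k d)) (redModIter t k d)
        (x : QuotTwisted (IwasawaAlgebra p ⧸ I (k + d)) (M (k + d)))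
  | 0, x => by
    rw [AdicTower.redIter_zero]
    refine (κ.coeffTwistReduce_id_apply (mk_one_add_X_pow_prime_pow_eq_one (I (k + 0)) (hJ (k + 0)))
      (f := redModIter t k 0) (fun _ ↦ rfl) _).symm.trans ?_
    exact κ.coeffTwistReduce_congr _ _ rfl _ (Ideal.Quotient.ringHom_ext (RingHom.ext fun g ↦
      (Ideal.Quotient.factor_mk (le_of_succ_le I hI k 0) g).symm)) (fun _ ↦ rfl) _
  | d + 1, x => by
    rw [AdicTower.redIter_succ, coeffAdicTower_red_apply, redIter_coeffAdicTower_apply k d]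
    change κ.coeffTwistReduce _ _ _ _ (redModIter t k d) (κ.coeffLevelReduce ρ t I hI J hJ (k + d) _) = _
    rw [coeffLevelReduce, coeffTwistReduce_comp_apply]
    exact κ.coeffTwistReduce_congr _ _ _ _ (Ideal.Quotient.ringHom_ext (RingHom.ext fun g ↦
      ((congrArg (Ideal.Quotient.factor (le_of_succ_le I hI k d)) (Ideal.Quotient.factor_mk (hI (k + d)) g)).trans
        (Ideal.Quotient.factor_mk (le_of_succ_le I hI k d) g)).trans
          (Ideal.Quotient.factor_mk (le_of_succ_le I hI k (d + 1)) g).symm)) (fun _ ↦ rfl) _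

end Tower

/-! ## §3 D1's Eisenstein reductions as coefficient/module changes -/

section Eisenstein

universe u

variable {K : Type u} [Field K] {p : ℕ} [hp : Fact p.Prime] (κ : ZpExtension K p)
  {M : Type u} [AddCommGroup M] [TopologicalSpace M] [DiscreteTopology M] {ρ : DiscreteGaloisModule K M}
  {M' : Type u} [AddCommGroup M'] [TopologicalSpace M'] [DiscreteTopology M'] {ρ' : DiscreteGaloisModule K M'}
  {m : ℕ} (hm : 1 ≤ m) {k k' : ℕ} (hkk' : k ≤ k')

/-- **D1's `eisensteinTwistReduce hm hkk′ f` IS `coeffTwistReduce` along `reduce p m hkk′ : A_{m,k′} ↠ A_{m,k}` and `f`**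
(both additive and equal on pure tensors). [cite: Howard2004HeegnerKolyvagin, §2.2 and Rem. 1.2.4] -/
theorem eisensteinTwistReduce_eq_coeffTwistReduce (f : ρ.toContRepresentation →ⁱL ρ'.toContRepresentation)
    (x : IwasawaAlgebra.EisensteinCoeff.Twisted p m k' M) :
    κ.eisensteinTwistReduce hm hkk' f x =
      κ.coeffTwistReduce (onePlusT_pow_prime_pow_eisensteinLevel (p := p) hm k')
        (onePlusT_pow_prime_pow_eisensteinLevel (p := p) hm k) (IwasawaAlgebra.EisensteinCoeff.reduce p m hkk')
        (IwasawaAlgebra.EisensteinCoeff.reduce_onePlusT m hkk') f x := by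
  induction x using CoeffExtension.induction_on with
  | zero => simp only [map_zero]
  | tmul c a => rw [coeffTwistReduce_tmul]; exact κ.eisensteinTwistReduce_tmul hm hkk' f c a
  | add x y hx hy => rw [map_add, map_add, hx, hy]

end Eisenstein

/-! ## §4 The `f_red` square from the Shapiro-diagonal source to the Eisenstein target -/

section Square

variable {K : Type} [Field K] [NumberField K] {V : WeierstrassCurve K} [V.IsElliptic] {p : ℕ} [hp : Fact p.Prime]
  (κ : ZpExtension K p)
  (t : ∀ k, (V.torsionGaloisModule ((p : ℤ) ^ (k + 1))).toContRepresentation →ⁱL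
    (V.torsionGaloisModule ((p : ℤ) ^ k)).toContRepresentation)
  (ht : ∀ k (P : WeierstrassCurve.geomTorsion V ((p : ℤ) ^ (k + 1))), t k P = V.geomTorsionReduce p k P)
  (hts : ∀ k, Function.Surjective (t k)) {m : ℕ} (hm : 1 ≤ m)

include ht in
omit [NumberField K] [V.IsElliptic] in
/-- **The `f_red` square of the pushforward's level maps**: for Shapiro levels `σ′ = σ + d ≥ σ`, target levels `k + 2 ≥ k + 1`
(`k + 1 ≤ σ`, `k + 2 ≤ σ + d`) and the two ideal inclusions, reducing in the SOURCE (`redIter` of the Shapiro `coeffAdicTower`,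
i.e. the `red` of any reindexing `σ = idxSeq s₀ d k`) then mapping at level `k+1` equals mapping at level `k+2` then reducing
in the TARGET (D1's `eisensteinTwistReduce hm _ (t (k+1))` = `eisensteinAdicTowerSucc.red k`).
[cite: Howard2004HeegnerKolyvagin, Rem. 1.2.4 (arXiv p. 7, L13–27) and §1.6 (arXiv p. 12, L29–33)] -/
theorem shapiroToEisensteinTwistLe_redIter (σ d k : ℕ) (hσ : k + 1 ≤ σ) (hσ' : k + 2 ≤ σ + d)
    (hle : shapiroIdeal p σ ≤ Ideal.span {(PowerSeries.X ^ m + PowerSeries.C (p : ℤ_[p]) : IwasawaAlgebra p)} ⊔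
      Ideal.span {PowerSeries.C ((p : ℤ_[p]) ^ (k + 1))})
    (hle' : shapiroIdeal p (σ + d) ≤ Ideal.span {(PowerSeries.X ^ m + PowerSeries.C (p : ℤ_[p]) : IwasawaAlgebra p)} ⊔
      Ideal.span {PowerSeries.C ((p : ℤ_[p]) ^ (k + 2))})
    (x : CoeffLevel p (shapiroIdeal p) (fun j ↦ WeierstrassCurve.geomTorsion V ((p : ℤ) ^ j)) (σ + d)) :
    κ.shapiroToEisensteinTwistLe V hm σ (k + 1) hσ hle
        ((κ.coeffAdicTower (fun j ↦ V.torsionGaloisModule ((p : ℤ) ^ j)) t (shapiroIdeal p) (shapiroIdeal_succ_le p)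
          (fun j ↦ j) (omega_mem_shapiroIdeal p) (fun j ↦ j * p ^ j + j) (maximalIdeal_pow_le_shapiroIdeal p) hts).redIter
          σ d x) =
      κ.eisensteinTwistReduce hm (Nat.le_succ (k + 1)) (t (k + 1))
        (κ.shapiroToEisensteinTwistLe V hm (σ + d) (k + 2) hσ' hle'
          (x : QuotTwisted (IwasawaAlgebra p ⧸ shapiroIdeal p (σ + d)) (WeierstrassCurve.geomTorsion V ((p : ℤ) ^ (σ + d))))) := by
  rw [redIter_coeffAdicTower_apply, eisensteinTwistReduce_eq_coeffTwistReduce]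
  refine κ.coeffTwistReduce_comp_eq_of _ _ _ _ _ _ _ _ _ _ _ _
    (Ideal.Quotient.ringHom_ext (RingHom.ext fun g ↦ ?_)) _ _ _ _ (fun P ↦ Subtype.ext ?_) _
  · simp only [RingHom.comp_apply, Ideal.Quotient.factor_mk, shapiroToEisensteinCoeff_mk,
      IwasawaAlgebra.EisensteinCoeff.reduce_mk]
  · rw [WeierstrassCurve.coe_torsionGaloisModulePowReduce, coe_redModIter V p t ht, ht,
      WeierstrassCurve.coe_geomTorsionReduce, WeierstrassCurve.coe_torsionGaloisModulePowReduce, smul_smul, smul_smul,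
      ← pow_add, ← pow_succ']
    congr 2
    omega

end Square

end Literature.NumberTheory.EllipticCurves.ZpExtension

end
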